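import Summits.BirchSwinnertonDyer.BirchSwinnertonDyer.Theorems.AlignedTransportAtTwoMainConjectureTransportAlignedAtTwoOrdPlusLineWitnessClasses
import HarnessLib

/-!
# Crux C1 `MainConjectureTransportAlignedAtTwo` (stmt-BirchSwinnertonDyer-22296), line `birth`, the `Δ > 0` half (R1) of the promoted residual:
# ONE WITNESS SUFFICES — the invariant odd PLUS witness (I) is REDUNDANT given the `μ = 0` theorem for the second curve; the Λ-level selection
# from the single ANTI-INVARIANT odd MINUS witness (II) (width seat att-p4 g12; `--supports 22296`)

THEOREMS ONLY (no `def`, no `sorry`, no new named fact). BSD is not proved by this; C1 is not closed by this.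

Sharpening of `…OrdPlusLineWitness.periodFunctionals_congr_mod_two_of_witnesses`. In the trichotomy `h ∈ {0, f, g, f + g}` (`f = n̄₁`, `g = m̄₁`,
`h = n̄₂` on `Λ = periodHomology N'`, from (K4)), the anti-invariant witness `z` (with `f z = h z = 0`, `g z = 1`) alone excludes `h = g` and
`h = f + g`; and `h ≠ 0` is an odd value of `n₂` SOMEWHERE on `Λ`, which for the depleted form of a good-ordinary `S₃` curve is the tree's `μ = 0`
THEOREM (`…OrdPlusLineOdd.exists_odd_depleted_periodFunctional`, used by the lead for both curves). So:
* §1 **`periodFunctionals_congr_mod_two_of_antiInvariant_witness`** — hypotheses of `…_of_witnesses` with (I) replaced by «`n₂` odd somewhere»;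
  **`…_of_real_antiInvariant_witness`** ((II) := `γ ∈ Γ₀(N')` with `{∞,(εγε)∞} = −{∞,γ∞}` and `m₁(γ)` odd) and **`…_of_matrix_witness`**
  ((II) := `γ = (a b; c a) ∈ Γ₀(N')` with `m₁(γ) = (2D/Ω⁻₁)·im{∞, a/c}_{g₁}` odd).
The `λ`-law against the single witness is the companion file `…OrdPlusLineWitnessMinusLaw`.

HONEST CAVEATS (unchanged in substance, now one-sided): (II) holds only in LINE position (cross/sum partners of `W₁` admissible at the same `(N', SS)`
refute it); `Δ(W₁) < 0` makes it unsatisfiable (`n̄₁ = m̄₁`); and — NEW, recorded in `Cruxes/…/DELTA-POS-WITNESS-att-p4-g12.md` §2(e) — if `X₀(N₁)(ℝ)`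
is CONNECTED (`N₁` an odd prime power, Snowden 2011 Prop. 1.2.1) then `Λ⁻_{N₁} = (1−ι)Λ_{N₁}` (Gross–Harris), every minus value of `f₁` on it is even,
and by `ι`-equivariance of the degeneracy push-forwards (II) fails at EVERY admissible level: the witness route needs a curve of the pair with at least
two odd primes in its conductor in the role of `W₁` (the `λ`-law is symmetric, so either curve may play `W₁`).

References: Buzzard 2000 Prop. 2.4 [Buzzard2000LevelLoweringModTwo]; Darmon–Diamond–Taylor 1995 §1.6, §4.5 [DarmonDiamondTaylor1995]; Manin 1972 §1.6
[Manin1972]; Cremona 1997 §2.1, §2.8 [CremonaAlgorithms1997]; Greenberg–Vatsal 2000 §3 Rem. 3.4 [GreenbergVatsal2000]; Snowden, *Real components of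
modular curves* (2011) Prop. 1.2.1.
-/

noncomputable section

-- justification: the `Summit.BirchSwinnertonDyer.BirchSwinnertonDyer.…` path repeats a component (route-file convention)
set_option linter.dupNamespace false
set_option autoImplicit false

open scoped MatrixGroups ComplexConjugate ModularForm NumberField Classical
open CongruenceSubgroup Complex WeierstrassCurve IsDedekindDomain
open Literature.NumberTheory.EllipticCurves Literature.NumberTheory.EllipticCurves.ModularForms
open Literature.NumberTheory.EllipticCurves.Greenberg1999 Rat.HeightOneSpectrum
open Summit.BirchSwinnertonDyer.BirchSwinnertonDyer.Theorems.ThetaLayerLambdaCongruenceAtTwo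
open Summit.BirchSwinnertonDyer.BirchSwinnertonDyer.Theorems.AlignedTransportAtTwoBuzzardKFour
open Summit.BirchSwinnertonDyer.BirchSwinnertonDyer.Theorems.AlignedTransportAtTwoOrdPlusLineWitness
open Summit.BirchSwinnertonDyer.BirchSwinnertonDyer.Theorems.AlignedTransportAtTwoOrdPlusLineWitnessClasses

namespace Summit.BirchSwinnertonDyer.BirchSwinnertonDyer.Theorems.AlignedTransportAtTwoOrdPlusLineWitnessMinus

/-! ## §1 Selection from the single anti-invariant witness -/

section Congruence

variable (W₁ : WeierstrassCurve ℚ) [W₁.IsElliptic] [W₁.IsGloballyMinimal]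

/-- **SELECTION OFF THE KILFORD STRATUM FROM ONE ANTI-INVARIANT WITNESS, NO SIGN CONDITION.** As
`…OrdPlusLineWitness.periodFunctionals_congr_mod_two_of_witnesses`, but the invariant plus witness (I) is replaced by «`n₂` takes an odd value
somewhere on `Λ`» (`hodd₂`): with `f = n̄₁`, `g = m̄₁`, `h = n̄₂` and the (K4) trichotomy `h ∈ {0, f, g, f+g}`, the witness `z` (`f z = h z = 0`,
`g z = 1`) excludes `g` and `f + g`, `hodd₂` excludes `0`. Conclusion: `n₁ ≡ n₂ (mod 2)` on `Λ`.
[cite: Buzzard2000LevelLoweringModTwo, Prop. 2.4] [cite: DarmonDiamondTaylor1995, §1.6 Lemma 1.38 and §4.5 Thm. 4.26]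
[cite: GreenbergVatsal2000, §3 Remark 3.4] -/
theorem periodFunctionals_congr_mod_two_of_antiInvariant_witness
    (hSD : heckeSelfDual_torsionBy_J0) (hBz : buzzard2000_multiplicityOne_gamma0)
    (ht : ∀ x : ℚ, ¬ HasRationalTwoTorsionX W₁ x) (hΔ₂ : ∀ s : ℚ_[2], s ^ 2 ≠ (W₁.Δ : ℚ_[2]))
    {N : ℕ} [NeZero N] {f : CuspForm (Gamma0 N) 2} (hf : IsNewformOf W₁ f)
    (S : Finset ℕ) (hS : ∀ ℓ ∈ S, ℓ.Prime)
    (N' : ℕ) [NeZero N'] (hN' : Odd N') (hNL : N * ∏ ℓ ∈ S, ℓ ^ 2 ∣ N') (hLS : ∀ p : ℕ, p.Prime → p ∣ N' → p ∈ S)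
    (hgood : ∀ v : HeightOneSpectrum (𝓞 ℚ), ¬ ((primesEquiv v : ℕ) ∣ 2 * N') → W₁.HasGoodReductionAt v)
    (g₁ g₂ : CuspForm (Gamma0 N') 2) (a₂ : ℕ → ℤ)
    (hT₁ : ∀ (q : ℕ) (hq : q.Prime), ¬ q ∣ N' →
      (haveI : NeZero q := ⟨hq.ne_zero⟩; heckeT (Gamma0 N') 2 q g₁) = ((W₁.LFunction q : ℤ) : ℂ) • g₁)
    (hT₂ : ∀ (q : ℕ) (hq : q.Prime), ¬ q ∣ N' →
      (haveI : NeZero q := ⟨hq.ne_zero⟩; heckeT (Gamma0 N') 2 q g₂) = ((a₂ q : ℤ) : ℂ) • g₂)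
    (hcong : ∀ (q : ℕ), q.Prime → ¬ q ∣ N' → Even (a₂ q - W₁.LFunction q))
    (hU₁ : ∀ (q : ℕ) (hq : q.Prime), q ∣ N' → (haveI : NeZero q := ⟨hq.ne_zero⟩; heckeT (Gamma0 N') 2 q g₁) = 0)
    (hU₂ : ∀ (q : ℕ) (hq : q.Prime), q ∣ N' → (haveI : NeZero q := ⟨hq.ne_zero⟩; heckeT (Gamma0 N') 2 q g₂) = 0)
    (c₁ c₂ c₃ : ℝ)
    (hint₁ : ∀ x ∈ periodHomology N', ∃ z : ℤ, c₁ * (x g₁).re = z)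
    (hint₂ : ∀ x ∈ periodHomology N', ∃ z : ℤ, c₂ * (x g₂).re = z)
    (hint₃ : ∀ x ∈ periodHomology N', ∃ z : ℤ, c₃ * (x g₁).im = z)
    (hodd₁ : ∃ x ∈ periodHomology N', ∃ z : ℤ, c₁ * (x g₁).re = z ∧ Odd z)
    (hodd₂ : ∃ x ∈ periodHomology N', ∃ z : ℤ, c₂ * (x g₂).re = z ∧ Odd z)
    (hII : ∃ z ∈ periodHomology N', ∃ u v w : ℤ,
      c₁ * (z g₁).re = u ∧ Even u ∧ c₂ * (z g₂).re = v ∧ Even v ∧ c₃ * (z g₁).im = w ∧ Odd w)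
    {x : Module.Dual ℂ (CuspForm (Gamma0 N') 2)} (hx : x ∈ periodHomology N')
    {z₁ z₂ : ℤ} (hz₁ : c₁ * (x g₁).re = z₁) (hz₂ : c₂ * (x g₂).re = z₂) : (Even z₁ ↔ Even z₂) := by
  classical
  -- uniqueness of the integer value
  have huniq : ∀ {r : ℝ} {z z' : ℤ}, r = z → r = z' → z = z' := by
    intro r z z' h h'
    exact_mod_cast h.symm.trans h'
  -- the subgroup `K = {x : n₁, n₂, m₁ all even}`
  let K : AddSubgroup (Module.Dual ℂ (CuspForm (Gamma0 N') 2)) :=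
    { carrier := {y | ∃ w₁ w₂ w₃ : ℤ, c₁ * (y g₁).re = 2 * w₁ ∧ c₂ * (y g₂).re = 2 * w₂ ∧ c₃ * (y g₁).im = 2 * w₃}
      zero_mem' := ⟨0, 0, 0, by simp, by simp, by simp⟩
      add_mem' := by
        rintro y y' ⟨w₁, w₂, w₃, h₁, h₂, h₃⟩ ⟨w₁', w₂', w₃', h₁', h₂', h₃'⟩
        refine ⟨w₁ + w₁', w₂ + w₂', w₃ + w₃', ?_, ?_, ?_⟩
        · rw [LinearMap.add_apply, Complex.add_re, mul_add, h₁, h₁']; push_cast; ring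
        · rw [LinearMap.add_apply, Complex.add_re, mul_add, h₂, h₂']; push_cast; ring
        · rw [LinearMap.add_apply, Complex.add_im, mul_add, h₃, h₃']; push_cast; ring
      neg_mem' := by
        rintro y ⟨w₁, w₂, w₃, h₁, h₂, h₃⟩
        refine ⟨-w₁, -w₂, -w₃, ?_, ?_, ?_⟩
        · rw [LinearMap.neg_apply, Complex.neg_re, mul_neg, h₁]; push_cast; ring
        · rw [LinearMap.neg_apply, Complex.neg_re, mul_neg, h₂]; push_cast; ring
        · rw [LinearMap.neg_apply, Complex.neg_im, mul_neg, h₃]; push_cast; ring }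
  have hKmem : ∀ {y : Module.Dual ℂ (CuspForm (Gamma0 N') 2)},
      y ∈ K ↔ ∃ w₁ w₂ w₃ : ℤ, c₁ * (y g₁).re = 2 * w₁ ∧ c₂ * (y g₂).re = 2 * w₂ ∧ c₃ * (y g₁).im = 2 * w₃ := Iff.rfl
  -- membership in terms of parities of the three integer values
  have hKiff : ∀ {y : Module.Dual ℂ (CuspForm (Gamma0 N') 2)} {u₁ u₂ u₃ : ℤ}, c₁ * (y g₁).re = u₁ → c₂ * (y g₂).re = u₂ →
      c₃ * (y g₁).im = u₃ → (y ∈ K ↔ Even u₁ ∧ Even u₂ ∧ Even u₃) := by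
    intro y u₁ u₂ u₃ hu₁ hu₂ hu₃
    rw [hKmem]
    constructor
    · rintro ⟨w₁, w₂, w₃, h₁, h₂, h₃⟩
      have e₁ : u₁ = 2 * w₁ := huniq hu₁ (by rw [h₁]; push_cast; ring)
      have e₂ : u₂ = 2 * w₂ := huniq hu₂ (by rw [h₂]; push_cast; ring)
      have e₃ : u₃ = 2 * w₃ := huniq hu₃ (by rw [h₃]; push_cast; ring)
      exact ⟨⟨w₁, by rw [e₁]; ring⟩, ⟨w₂, by rw [e₂]; ring⟩, ⟨w₃, by rw [e₃]; ring⟩⟩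
    · rintro ⟨⟨w₁, hw₁⟩, ⟨w₂, hw₂⟩, ⟨w₃, hw₃⟩⟩
      refine ⟨w₁, w₂, w₃, ?_, ?_, ?_⟩
      · rw [hu₁, hw₁]; push_cast; ring
      · rw [hu₂, hw₂]; push_cast; ring
      · rw [hu₃, hw₃]; push_cast; ring
  -- `2Λ ⊆ K`
  have h2K : ∀ u ∈ periodHomology N', (2 : ℂ) • u ∈ K := by
    intro u hu
    obtain ⟨v₁, hv₁⟩ := hint₁ u hu
    obtain ⟨v₂, hv₂⟩ := hint₂ u hu
    obtain ⟨v₃, hv₃⟩ := hint₃ u hu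
    refine ⟨v₁, v₂, v₃, ?_, ?_, ?_⟩
    · rw [LinearMap.smul_apply, smul_eq_mul, show ((2 : ℂ) * u g₁).re = 2 * (u g₁).re by simp [Complex.mul_re], ← mul_assoc,
        mul_comm c₁, mul_assoc, hv₁]
    · rw [LinearMap.smul_apply, smul_eq_mul, show ((2 : ℂ) * u g₂).re = 2 * (u g₂).re by simp [Complex.mul_re], ← mul_assoc,
        mul_comm c₂, mul_assoc, hv₂]
    · rw [LinearMap.smul_apply, smul_eq_mul, show ((2 : ℂ) * u g₁).im = 2 * (u g₁).im by simp [Complex.mul_im], ← mul_assoc,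
        mul_comm c₃, mul_assoc, hv₃]
  -- `(T_q^∨ − a_q(W₁))Λ ⊆ K`
  have hTK : ∀ (q : ℕ) (hq : q.Prime), ¬ q ∣ N' → ∀ u ∈ periodHomology N',
      (haveI : NeZero q := ⟨hq.ne_zero⟩; heckeT (Gamma0 N') 2 q).dualMap u - (W₁.LFunction q : ℂ) • u ∈ K := by
    intro q hq hqN u hu
    haveI : NeZero q := ⟨hq.ne_zero⟩
    obtain ⟨v₂, hv₂⟩ := hint₂ u hu
    obtain ⟨k, hk⟩ := hcong q hq hqN
    have e₁ : ((heckeT (Gamma0 N') 2 q).dualMap u - (W₁.LFunction q : ℂ) • u) g₁ = 0 := by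
      simp only [LinearMap.sub_apply, LinearMap.dualMap_apply, hT₁ q hq hqN, map_smul, LinearMap.smul_apply, smul_eq_mul]
      rw [sub_self]
    refine ⟨0, k * v₂, 0, ?_, ?_, ?_⟩
    · rw [e₁, Complex.zero_re, mul_zero]; push_cast; ring
    · have e : ((heckeT (Gamma0 N') 2 q).dualMap u - (W₁.LFunction q : ℂ) • u) g₂ = ((a₂ q - W₁.LFunction q : ℤ) : ℂ) * u g₂ := by
        simp only [LinearMap.sub_apply, LinearMap.dualMap_apply, hT₂ q hq hqN, map_smul, LinearMap.smul_apply, smul_eq_mul]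
        push_cast; ring
      rw [e, show ((((a₂ q - W₁.LFunction q : ℤ)) : ℂ) * u g₂).re = (a₂ q - W₁.LFunction q : ℤ) * (u g₂).re by
        simp [Complex.mul_re], hk, ← mul_assoc, mul_comm c₂, mul_assoc, hv₂]
      push_cast; ring
    · rw [e₁, Complex.zero_im, mul_zero]; push_cast; ring
  -- `U_ℓ^∨Λ ⊆ K`
  have hUK : ∀ (q : ℕ) (hq : q.Prime), q ∣ N' → ∀ u ∈ periodHomology N',
      (haveI : NeZero q := ⟨hq.ne_zero⟩; heckeT (Gamma0 N') 2 q).dualMap u ∈ K := by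
    intro q hq hqN u _
    haveI : NeZero q := ⟨hq.ne_zero⟩
    refine ⟨0, 0, 0, ?_, ?_, ?_⟩
    · rw [LinearMap.dualMap_apply, hU₁ q hq hqN, map_zero, Complex.zero_re, mul_zero]; push_cast; ring
    · rw [LinearMap.dualMap_apply, hU₂ q hq hqN, map_zero, Complex.zero_re, mul_zero]; push_cast; ring
    · rw [LinearMap.dualMap_apply, hU₁ q hq hqN, map_zero, Complex.zero_im, mul_zero]; push_cast; ring
  -- the three mod-2 functionals `F₁ = n̄₁`, `F₂ = n̄₂`, `F₃ = m̄₁` on `Λ`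
  obtain ⟨F₁, hF₁⟩ := exists_parityHom (periodHomology N') (fun y ↦ c₁ * (y g₁).re)
    (fun y y' ↦ by rw [LinearMap.add_apply, Complex.add_re, mul_add]) hint₁
  obtain ⟨F₂, hF₂⟩ := exists_parityHom (periodHomology N') (fun y ↦ c₂ * (y g₂).re)
    (fun y y' ↦ by rw [LinearMap.add_apply, Complex.add_re, mul_add]) hint₂
  obtain ⟨F₃, hF₃⟩ := exists_parityHom (periodHomology N') (fun y ↦ c₃ * (y g₁).im)
    (fun y y' ↦ by rw [LinearMap.add_apply, Complex.add_im, mul_add]) hint₃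
  -- they kill `K ∩ Λ`
  have hkill : ∀ y : periodHomology N', (y : Module.Dual ℂ (CuspForm (Gamma0 N') 2)) ∈ K → F₁ y = 0 ∧ F₂ y = 0 ∧ F₃ y = 0 := by
    intro y hy
    obtain ⟨u₁, hu₁⟩ := hint₁ y y.2
    obtain ⟨u₂, hu₂⟩ := hint₂ y y.2
    obtain ⟨u₃, hu₃⟩ := hint₃ y y.2
    obtain ⟨he₁, he₂, he₃⟩ := (hKiff hu₁ hu₂ hu₃).mp hy
    exact ⟨(hF₁ y y.2 u₁ hu₁).trans ((intCast_zmod_two_eq_zero_iff_even u₁).mpr he₁),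
      (hF₂ y y.2 u₂ hu₂).trans ((intCast_zmod_two_eq_zero_iff_even u₂).mpr he₂),
      (hF₃ y y.2 u₃ hu₃).trans ((intCast_zmod_two_eq_zero_iff_even u₃).mpr he₃)⟩
  -- the witness and the two odd values, read as values of `F₁, F₂, F₃`
  obtain ⟨z, hz, uz, vz, wz, huz, huzev, hvz, hvzev, hwz, hwzodd⟩ := hII
  obtain ⟨x₁, hx₁, u₁, hu₁, hu₁odd⟩ := hodd₁
  obtain ⟨x₂, hx₂, u₂, hu₂, hu₂odd⟩ := hodd₂
  have hF₂x₂ : F₂ ⟨x₂, hx₂⟩ ≠ 0 := fun h ↦ (Int.not_even_iff_odd.mpr hu₂odd)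
    ((intCast_zmod_two_eq_zero_iff_even u₂).mp ((hF₂ x₂ hx₂ u₂ hu₂).symm.trans h))
  have hF₁z : F₁ ⟨z, hz⟩ = 0 := (hF₁ z hz uz huz).trans ((intCast_zmod_two_eq_zero_iff_even uz).mpr huzev)
  have hF₂z : F₂ ⟨z, hz⟩ = 0 := (hF₂ z hz vz hvz).trans ((intCast_zmod_two_eq_zero_iff_even vz).mpr hvzev)
  have hF₃z : F₃ ⟨z, hz⟩ ≠ 0 := fun h ↦ (Int.not_even_iff_odd.mpr hwzodd)
    ((intCast_zmod_two_eq_zero_iff_even wz).mp ((hF₃ z hz wz hwz).symm.trans h))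
  have hF₁x₁ : F₁ ⟨x₁, hx₁⟩ ≠ 0 := fun h ↦ (Int.not_even_iff_odd.mpr hu₁odd)
    ((intCast_zmod_two_eq_zero_iff_even u₁).mp ((hF₁ x₁ hx₁ u₁ hu₁).symm.trans h))
  have hF₁0 : F₁ ≠ 0 := fun h ↦ hF₁x₁ (by rw [h, AddMonoidHom.zero_apply])
  have hF₃0 : F₃ ≠ 0 := fun h ↦ hF₃z (by rw [h, AddMonoidHom.zero_apply])
  have hF₁₃ : F₁ ≠ F₃ := fun h ↦ hF₃z (by rw [← h, hF₁z])
  -- (K4) trichotomy and selection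
  have htri : F₂ = 0 ∨ F₂ = F₁ ∨ F₂ = F₃ ∨ F₂ = F₁ + F₃ :=
    trichotomy_of_dvd_S3 hSD hBz W₁ ht hΔ₂ hf S hS N' hN' hNL hLS hgood K h2K hTK hUK F₁ F₃ F₂
      (fun y hy ↦ (hkill y hy).1) (fun y hy ↦ (hkill y hy).2.2) (fun y hy ↦ (hkill y hy).2.1) hF₁0 hF₃0 hF₁₃
  -- selection by the single anti-invariant witness: `h ≠ 0` (odd value of `n₂`), `h z = 0 ≠ g z = (f+g) z`
  have hsel : F₂ = F₁ := by
    rcases htri with h0 | h1 | h2 | h3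
    · exact absurd (by rw [h0, AddMonoidHom.zero_apply]) hF₂x₂
    · exact h1
    · exact absurd (by rw [← h2]; exact hF₂z) hF₃z
    · refine absurd ?_ hF₃z
      have e := hF₂z
      rw [h3, AddMonoidHom.add_apply, hF₁z, zero_add] at e
      exact e
  -- read off at `x`
  have e₁ := hF₁ x hx z₁ hz₁
  have e₂ := hF₂ x hx z₂ hz₂
  rw [hsel, e₁] at e₂
  rw [← intCast_zmod_two_eq_zero_iff_even z₁, ← intCast_zmod_two_eq_zero_iff_even z₂, e₂]


/-- **Geometric form: one anti-invariant class of the real structure.** (II) := `γ ∈ Γ₀(N')` with `{∞,(εγε)∞} = −{∞,γ∞}` in `Λ` and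
`m₁(γ) = c₃·im{∞,γ∞}_{g₁}` odd (plus functionals of REAL forms vanish on such classes over `ℤ`). [cite: Manin1972, §1.6]
[cite: Buzzard2000LevelLoweringModTwo, Prop. 2.4] [cite: GreenbergVatsal2000, §3 Remark 3.4] -/
theorem periodFunctionals_congr_mod_two_of_real_antiInvariant_witness
    (hSD : heckeSelfDual_torsionBy_J0) (hBz : buzzard2000_multiplicityOne_gamma0)
    (ht : ∀ x : ℚ, ¬ HasRationalTwoTorsionX W₁ x) (hΔ₂ : ∀ s : ℚ_[2], s ^ 2 ≠ (W₁.Δ : ℚ_[2]))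
    {N : ℕ} [NeZero N] {f : CuspForm (Gamma0 N) 2} (hf : IsNewformOf W₁ f)
    (S : Finset ℕ) (hS : ∀ ℓ ∈ S, ℓ.Prime)
    (N' : ℕ) [NeZero N'] (hN' : Odd N') (hNL : N * ∏ ℓ ∈ S, ℓ ^ 2 ∣ N') (hLS : ∀ p : ℕ, p.Prime → p ∣ N' → p ∈ S)
    (hgood : ∀ v : HeightOneSpectrum (𝓞 ℚ), ¬ ((primesEquiv v : ℕ) ∣ 2 * N') → W₁.HasGoodReductionAt v)
    (g₁ g₂ : CuspForm (Gamma0 N') 2) (hreal₁ : ∀ n, (cuspCoeff g₁ n).im = 0) (hreal₂ : ∀ n, (cuspCoeff g₂ n).im = 0) (a₂ : ℕ → ℤ)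
    (hT₁ : ∀ (q : ℕ) (hq : q.Prime), ¬ q ∣ N' →
      (haveI : NeZero q := ⟨hq.ne_zero⟩; heckeT (Gamma0 N') 2 q g₁) = ((W₁.LFunction q : ℤ) : ℂ) • g₁)
    (hT₂ : ∀ (q : ℕ) (hq : q.Prime), ¬ q ∣ N' →
      (haveI : NeZero q := ⟨hq.ne_zero⟩; heckeT (Gamma0 N') 2 q g₂) = ((a₂ q : ℤ) : ℂ) • g₂)
    (hcong : ∀ (q : ℕ), q.Prime → ¬ q ∣ N' → Even (a₂ q - W₁.LFunction q))
    (hU₁ : ∀ (q : ℕ) (hq : q.Prime), q ∣ N' → (haveI : NeZero q := ⟨hq.ne_zero⟩; heckeT (Gamma0 N') 2 q g₁) = 0)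
    (hU₂ : ∀ (q : ℕ) (hq : q.Prime), q ∣ N' → (haveI : NeZero q := ⟨hq.ne_zero⟩; heckeT (Gamma0 N') 2 q g₂) = 0)
    (c₁ c₂ c₃ : ℝ)
    (hint₁ : ∀ x ∈ periodHomology N', ∃ z : ℤ, c₁ * (x g₁).re = z)
    (hint₂ : ∀ x ∈ periodHomology N', ∃ z : ℤ, c₂ * (x g₂).re = z)
    (hint₃ : ∀ x ∈ periodHomology N', ∃ z : ℤ, c₃ * (x g₁).im = z)
    (hodd₁ : ∃ x ∈ periodHomology N', ∃ z : ℤ, c₁ * (x g₁).re = z ∧ Odd z)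
    (hodd₂ : ∃ x ∈ periodHomology N', ∃ z : ℤ, c₂ * (x g₂).re = z ∧ Odd z)
    (hII : ∃ γ : Gamma0 N', periodFunctional N' ⟨iotaConj (γ : SL(2, ℤ)), iotaConj_coe_mem_gamma0 γ⟩ = -periodFunctional N' γ ∧
      ∃ w : ℤ, c₃ * (cuspSymbol g₁ γ).im = w ∧ Odd w)
    {x : Module.Dual ℂ (CuspForm (Gamma0 N') 2)} (hx : x ∈ periodHomology N')
    {z₁ z₂ : ℤ} (hz₁ : c₁ * (x g₁).re = z₁) (hz₂ : c₂ * (x g₂).re = z₂) : (Even z₁ ↔ Even z₂) := by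
  obtain ⟨δ, hδ, w, hw, hwodd⟩ := hII
  have hre : ∀ (g : CuspForm (Gamma0 N') 2), (∀ n, (cuspCoeff g n).im = 0) → (cuspSymbol g δ).re = 0 := by
    intro g hreal
    have h := congrArg (fun φ : Module.Dual ℂ (CuspForm (Gamma0 N') 2) ↦ (φ g).re) hδ
    simp only [periodFunctional_apply, LinearMap.neg_apply, Complex.neg_re, cuspSymbol_iotaConj g hreal δ, Complex.conj_re] at h
    linarith
  have hII' : ∃ z ∈ periodHomology N', ∃ u v w : ℤ,
      c₁ * (z g₁).re = u ∧ Even u ∧ c₂ * (z g₂).re = v ∧ Even v ∧ c₃ * (z g₁).im = w ∧ Odd w :=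
    ⟨periodFunctional N' δ, periodFunctional_mem_periodHomology N' δ, 0, 0, w,
      by rw [periodFunctional_apply, hre g₁ hreal₁, mul_zero, Int.cast_zero], ⟨0, rfl⟩,
      by rw [periodFunctional_apply, hre g₂ hreal₂, mul_zero, Int.cast_zero], ⟨0, rfl⟩,
      by rwa [periodFunctional_apply], hwodd⟩
  exact periodFunctionals_congr_mod_two_of_antiInvariant_witness W₁ hSD hBz ht hΔ₂ hf S hS N' hN' hNL hLS hgood g₁ g₂ a₂ hT₁ hT₂ hcong
    hU₁ hU₂ c₁ c₂ c₃ hint₁ hint₂ hint₃ hodd₁ hodd₂ hII' hx hz₁ hz₂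

/-- **Matrix form: `γ = (a b; c a) ∈ Γ₀(N')` with `m₁(γ)` odd** (its class is anti-invariant,
`…OrdPlusLineWitnessClasses.periodFunctional_iotaConj_eq_neg_of_apply_eq`). [cite: CremonaAlgorithms1997, §2.1 and §2.5]
[cite: Buzzard2000LevelLoweringModTwo, Prop. 2.4] [cite: GreenbergVatsal2000, §3 Remark 3.4] -/
theorem periodFunctionals_congr_mod_two_of_matrix_witness
    (hSD : heckeSelfDual_torsionBy_J0) (hBz : buzzard2000_multiplicityOne_gamma0)
    (ht : ∀ x : ℚ, ¬ HasRationalTwoTorsionX W₁ x) (hΔ₂ : ∀ s : ℚ_[2], s ^ 2 ≠ (W₁.Δ : ℚ_[2]))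
    {N : ℕ} [NeZero N] {f : CuspForm (Gamma0 N) 2} (hf : IsNewformOf W₁ f)
    (S : Finset ℕ) (hS : ∀ ℓ ∈ S, ℓ.Prime)
    (N' : ℕ) [NeZero N'] (hN' : Odd N') (hNL : N * ∏ ℓ ∈ S, ℓ ^ 2 ∣ N') (hLS : ∀ p : ℕ, p.Prime → p ∣ N' → p ∈ S)
    (hgood : ∀ v : HeightOneSpectrum (𝓞 ℚ), ¬ ((primesEquiv v : ℕ) ∣ 2 * N') → W₁.HasGoodReductionAt v)
    (g₁ g₂ : CuspForm (Gamma0 N') 2) (hreal₁ : ∀ n, (cuspCoeff g₁ n).im = 0) (hreal₂ : ∀ n, (cuspCoeff g₂ n).im = 0) (a₂ : ℕ → ℤ)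
    (hT₁ : ∀ (q : ℕ) (hq : q.Prime), ¬ q ∣ N' →
      (haveI : NeZero q := ⟨hq.ne_zero⟩; heckeT (Gamma0 N') 2 q g₁) = ((W₁.LFunction q : ℤ) : ℂ) • g₁)
    (hT₂ : ∀ (q : ℕ) (hq : q.Prime), ¬ q ∣ N' →
      (haveI : NeZero q := ⟨hq.ne_zero⟩; heckeT (Gamma0 N') 2 q g₂) = ((a₂ q : ℤ) : ℂ) • g₂)
    (hcong : ∀ (q : ℕ), q.Prime → ¬ q ∣ N' → Even (a₂ q - W₁.LFunction q))
    (hU₁ : ∀ (q : ℕ) (hq : q.Prime), q ∣ N' → (haveI : NeZero q := ⟨hq.ne_zero⟩; heckeT (Gamma0 N') 2 q g₁) = 0)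
    (hU₂ : ∀ (q : ℕ) (hq : q.Prime), q ∣ N' → (haveI : NeZero q := ⟨hq.ne_zero⟩; heckeT (Gamma0 N') 2 q g₂) = 0)
    (c₁ c₂ c₃ : ℝ)
    (hint₁ : ∀ x ∈ periodHomology N', ∃ z : ℤ, c₁ * (x g₁).re = z)
    (hint₂ : ∀ x ∈ periodHomology N', ∃ z : ℤ, c₂ * (x g₂).re = z)
    (hint₃ : ∀ x ∈ periodHomology N', ∃ z : ℤ, c₃ * (x g₁).im = z)
    (hodd₁ : ∃ x ∈ periodHomology N', ∃ z : ℤ, c₁ * (x g₁).re = z ∧ Odd z)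
    (hodd₂ : ∃ x ∈ periodHomology N', ∃ z : ℤ, c₂ * (x g₂).re = z ∧ Odd z)
    (hII : ∃ γ : Gamma0 N', (γ : SL(2, ℤ)) 0 0 = (γ : SL(2, ℤ)) 1 1 ∧ ∃ w : ℤ, c₃ * (cuspSymbol g₁ γ).im = w ∧ Odd w)
    {x : Module.Dual ℂ (CuspForm (Gamma0 N') 2)} (hx : x ∈ periodHomology N')
    {z₁ z₂ : ℤ} (hz₁ : c₁ * (x g₁).re = z₁) (hz₂ : c₂ * (x g₂).re = z₂) : (Even z₁ ↔ Even z₂) := by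
  obtain ⟨γ, hγ, w, hw, hwodd⟩ := hII
  exact periodFunctionals_congr_mod_two_of_real_antiInvariant_witness W₁ hSD hBz ht hΔ₂ hf S hS N' hN' hNL hLS hgood g₁ g₂ hreal₁ hreal₂
    a₂ hT₁ hT₂ hcong hU₁ hU₂ c₁ c₂ c₃ hint₁ hint₂ hint₃ hodd₁ hodd₂
    ⟨γ, periodFunctional_iotaConj_eq_neg_of_apply_eq γ hγ, w, hw, hwodd⟩ hx hz₁ hz₂

end Congruence

end Summit.BirchSwinnertonDyer.BirchSwinnertonDyer.Theorems.AlignedTransportAtTwoOrdPlusLineWitnessMinus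

end
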